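import Summits.QuantumFields.BalabanUV.Beta.LagrangeFoldMixed

/-!
# `BalabanUV.Beta.LamCoeffKClosedForm` — binder row D1, located question X-an2-57 (t2′) ∕ compute line R-D1-X57-LAMCOEFF: **THE Λ-CONVERSION
# COEFFICIENTS OF THE STEP SYSTEM IN CLOSED FORM** — `lamCoeffK (KInvStep (j+1)) (E2 (j+1)) Lc μ y κ′ u′ = −(stepScale (j+1) ∕ wVH (j+1)) ·
# Σ'_v Σ_{m′} KInvStep (j+1) (Lc•y, v; inr μ, inr m′) · bhK Lc (v, u′; inr m′, inl κ′)`: the multiplier response to a background bond is MINUS the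
# multiplier block of the step resolvent read through the one-step border `𝒬_{Lc}` of that bond (β sub-cell, BINDER-OWNERS row D1 OWNER
# `b2b-balaban-beta-an2`, gen 34)

HONEST FRAMING (cell charter, verbatim): «discharging BetaPertH makes Balaban's UV stability UNCONDITIONAL — a real constructive-QFT result; it is
NOT the continuum limit and NOT the Clay problem.»  HONEST DEPENDENCY: continuum YM on T⁴ ⇐ BetaPertH ∧ nine spine estimates (0/9 proved);
BetaPertH ⇐ (D1) ∧ (D4) ∧ CAP+tail; G-an2-4 gates asym, D1 and NE2/3/4.
NOT IN PRINT; OUR BOOKKEEPING.  [folklore] kernel algebra over tree objects BY NAME: it is gen 29's residual identity (R1)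
`LagrangeFoldMixed.comp_KInvStep_bhKStep_inr_inl` (`(KInvStep (j+1) ∘ bhKStep (j+1))_{mf} = 0`) READ BACKWARDS — the field-leg part of that entry is
`wVH (j+1) · lamCoeffK` (`bhKStep_succ_inl_inl`), the multiplier-leg part is `stepScale (j+1) ·` the border term (`bhKStep_succ_inr_inl`), and they cancel.
No statement of Bałaban's papers, no `[cite:]`, no `def`, no `def … : Prop`; instantiates NO binder of the β-function wall.  NOT D1, NOT `BetaPertH`, NOT
continuum, NOT Clay.

WHY (records: requests.jsonl l.2036 ∕ l.2050 R-D1-X57-LAMCOEFF-SCALAR; journal [AN2-G34-X57-STRUCT]; memo `HOME/b2b-balaban-beta-an2/gen34/X57-SCALAR.v1.1.md` §7).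
Engine C's exact level-1 block `Λ(μ,κ′; u′ − 3y) = lamCoeffK (KInvStep 3 1) (E2 1) 3 μ y κ′ u′` (LAMCOEFF.md) was found, entry by entry (6561∕6561 at D = 3,
Bc = 3; 324∕900∕1764 at D = 2, Bc = 3∕5∕7), to be `−3^{−(D+1)}` times the 3-shift adjoint contour sum of ONE level-2 kernel.  This file is the kernel
statement behind that structure: since `bhK Lc (v, u′; inr m′, inl κ′) = [proj v = 0]·contourSum Lc (δ_{(κ′,u′)}) m′ (quo v)` (`BorderedHessianKernel.bhK_inr_inl`),
the right-hand side below is `−Lc^{−(d+2)}·Σ_{z} KInvStep (j+1)(Lc•y, Lc•z; inr μ, inr κ′)·#{contours of block z in direction κ′ through (κ′,u′)}` at `j+1 = 1`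
(`stepScale 1 ∕ wVH 1 = Lc^{−(d+2)}`) — the level-2 multiplier kernel re-indexed; PHYSICS: `Λ′[δB̃] = −E_{j+1}″ · 𝒬 δB̃`.
* §1 `E2_inr_inl` (the `(inr, inl)` entries of `E2` vanish), `tsum_lamCoeffK_eq` (the fold `lamCoeffK = Σ'_v Σ_κ A_{mf}·E2_{ff}`).
* §2 **`lamCoeffK_KInvStep_E2_eq`** — the closed form.
* §3 (v1.1, APPEND-ONLY) **`lamCoeffK_KInvStep_E2_eq_coarse`** — the same re-indexed over the COARSE sublattice (`InterLevelTransport.tsum_sublattice`,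
  `bhK_inr_inl`): `= −(stepScale∕wVH)(j+1) · Σ'_z Σ_{m′} KInvStep (j+1)(Lc•y, Lc•z; inr μ, inr m′) · contourSum Lc (δ_{(κ′,u′)}) m′ z` — the level-2 multiplier kernel
  against the INDICATOR COUNT of the straight `Lc`-contours of block `z` through the bond `(κ′,u′)` (Engine C's «3-shift» structure verbatim).
Provenance: β sub-cell, unit beta-an2 gen 34, 2026-08-21 (v1 p306095; v1.1 = + §3, every v1 declaration byte-identical); over `LagrangeFoldMixed` ∕ `LagrangeFoldStep` ∕ `BorderedHessianStepStraight` BY NAME; no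
existing file touched.
-/

noncomputable section

open Finset
open scoped BigOperators
open Literature.MathematicalPhysics.QuantumFieldTheory
open Literature.MathematicalPhysics.QuantumFieldTheory.Balaban1983to89
open Literature.MathematicalPhysics.QuantumFieldTheory.Balaban1983to89.Beta
open ExpKernelCalculus (MKer Decays comp)
open KernelWard (bdd_of_decays)
open OneStepResolventKernel (Fib eq_zsmul_quo_of_proj)
open AffineAveraging (contourSum)
open KKTFluctuationKernel (delta1)
open LatticeForm (quo)
open Literature.Probability.LatticeModels (Torus.proj)
open InterLevelTransport (tsum_sublattice)
open OneStepKernelFamily (KInvStep decays_KInvStep)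
open BalabanStepJetsSucc (E2 wVH lamCoeffK mmRead)
open Summit.QuantumFields.BalabanUV.Beta.TameKernelCalculus
open Summit.QuantumFields.BalabanUV.Beta.BorderedHessian (bhK bhK_inr_inl bhKStep bhKStep_succ_inl_inl bhKStep_succ_inr_inl spr_bhKStep stepScale stepScale_ne_zero)
open Summit.QuantumFields.BalabanUV.Beta.LagrangeFoldStep (GM_mf_split wVH_ne_zero)
open Summit.QuantumFields.BalabanUV.Beta.LagrangeFoldMixed (comp_KInvStep_bhKStep_inr_inl)

namespace Summit.QuantumFields.BalabanUV.Beta.LamCoeffKClosedForm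

variable {d Lc : ℕ} [NeZero Lc]

/-! ## §1 The fold `lamCoeffK = Σ' A_{mf}·E2_{ff}` -/

/-- [folklore] The `(inr, inl)` entries of the value Hessian `E2` vanish (`mmRead` lives on the field–field block). -/
theorem E2_inr_inl (j : ℕ) (v u : Fin (d + 1) → ℤ) (ν κ : Fin (d + 1)) : E2 d Lc j v u (Sum.inr ν) (Sum.inl κ) = 0 := rfl

/-- [folklore] **THE FOLD**: `lamCoeffK A (E2 (j+1)) Lc μ y κ′ u′ = Σ'_v Σ_κ A (Lc•y, v)(inr μ, inl κ) · E2 (j+1) (v, u′)(inl κ, inl κ′)` (the multiplier legs of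
the intermediate fibre drop by `E2_inr_inl`). -/
theorem tsum_lamCoeffK_eq (A : MKer (d + 1) (Fib d)) (j : ℕ) (μ : Fin (d + 1)) (y : Fin (d + 1) → ℤ) (κ' : Fin (d + 1))
    (u' : Fin (d + 1) → ℤ) :
    lamCoeffK A (E2 d Lc (j + 1)) Lc μ y κ' u'
      = ∑' v, ∑ κ : Fin (d + 1), A ((Lc : ℤ) • y) v (Sum.inr μ) (Sum.inl κ) * E2 d Lc (j + 1) v u' (Sum.inl κ) (Sum.inl κ') := by
  show comp A (E2 d Lc (j + 1)) ((Lc : ℤ) • y) u' (Sum.inr μ) (Sum.inl κ') = _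
  unfold ExpKernelCalculus.comp
  refine tsum_congr fun v => ?_
  rw [Fintype.sum_sum_type]
  simp only [E2_inr_inl, mul_zero, Finset.sum_const_zero, add_zero]

/-! ## §2 The closed form -/

/-- [folklore] **THE Λ-CONVERSION COEFFICIENTS OF THE STEP SYSTEM IN CLOSED FORM** (every level `j+1`, every `d`, every `Lc ≥ 1`):
`lamCoeffK (KInvStep (j+1)) (E2 (j+1)) Lc μ y κ′ u′ = −(stepScale (j+1) ∕ wVH (j+1)) · Σ'_v Σ_{m′} KInvStep (j+1) (Lc•y, v)(inr μ, inr m′) · bhK Lc (v, u′)(inr m′, inl κ′)`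
— (R1) `comp_KInvStep_bhKStep_inr_inl` split into its field-leg part (`wVH · lamCoeffK`) and its multiplier-leg part (`stepScale ·` the border term). -/
theorem lamCoeffK_KInvStep_E2_eq (j : ℕ) (μ : Fin (d + 1)) (y : Fin (d + 1) → ℤ) (κ' : Fin (d + 1)) (u' : Fin (d + 1) → ℤ) :
    lamCoeffK (KInvStep (d := d) Lc (j + 1)) (E2 d Lc (j + 1)) Lc μ y κ' u'
      = -(stepScale d Lc (j + 1) / wVH d Lc (j + 1)) *
          ∑' v, ∑ m' : Fin (d + 1), KInvStep (d := d) Lc (j + 1) ((Lc : ℤ) • y) v (Sum.inr μ) (Sum.inr m')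
            * bhK Lc v u' (Sum.inr m') (Sum.inl κ') := by
  set A := KInvStep (d := d) Lc (j + 1) with hAdef
  have hw : wVH d Lc (j + 1) ≠ 0 := wVH_ne_zero (j + 1)
  have hA : ∃ δ C : ℝ, 0 < δ ∧ 0 ≤ C ∧ Decays A C δ := decays_KInvStep (Lc := Lc) (d := d) (j + 1)
  obtain ⟨CM, δM, hδM, hMd⟩ := spr_bhKStep (d := d) (Lc := Lc) (j + 1)
  have hM : ∃ B : ℝ, ∀ x z a b, |bhKStep d Lc (j + 1) x z a b| ≤ B := ⟨CM, fun x z a b => bdd_of_decays hMd hδM.le x z a b⟩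
  -- (R1): the (inr μ, inl κ') entry of A ∘ 𝕄 vanishes; split it into field and multiplier legs
  have h0 := comp_KInvStep_bhKStep_inr_inl (d := d) (Lc := Lc) j ((Lc : ℤ) • y) u' μ κ'
  rw [GM_mf_split (G := A) (M := bhKStep d Lc (j + 1)) hA hM ((Lc : ℤ) • y) u' μ κ'] at h0
  -- field legs: wVH · lamCoeffK
  have hf : (∑' v, ∑ κ : Fin (d + 1), A ((Lc : ℤ) • y) v (Sum.inr μ) (Sum.inl κ) * bhKStep d Lc (j + 1) v u' (Sum.inl κ) (Sum.inl κ'))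
      = wVH d Lc (j + 1) * lamCoeffK A (E2 d Lc (j + 1)) Lc μ y κ' u' := by
    rw [tsum_lamCoeffK_eq, ← tsum_mul_left]
    refine tsum_congr fun v => ?_
    rw [Finset.mul_sum]
    refine Finset.sum_congr rfl fun κ _ => ?_
    rw [bhKStep_succ_inl_inl]
    ring
  -- multiplier legs: stepScale · the border term
  have hm : (∑' v, ∑ ν : Fin (d + 1), A ((Lc : ℤ) • y) v (Sum.inr μ) (Sum.inr ν) * bhKStep d Lc (j + 1) v u' (Sum.inr ν) (Sum.inl κ'))
      = stepScale d Lc (j + 1) *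
          ∑' v, ∑ m' : Fin (d + 1), A ((Lc : ℤ) • y) v (Sum.inr μ) (Sum.inr m') * bhK Lc v u' (Sum.inr m') (Sum.inl κ') := by
    rw [← tsum_mul_left]
    refine tsum_congr fun v => ?_
    rw [Finset.mul_sum]
    refine Finset.sum_congr rfl fun ν _ => ?_
    rw [bhKStep_succ_inr_inl]
    ring
  rw [hf, hm] at h0
  field_simp
  linear_combination h0

/-! ## §3 (v1.1) The closed form over the coarse sublattice -/

/-- [folklore] **THE CLOSED FORM RE-INDEXED OVER THE COARSE SUBLATTICE**: the border `bhK Lc (v, u′; inr m′, inl κ′)` is supported on coarse `v = Lc•z`,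
where it is the indicator count `contourSum Lc (δ_{(κ′,u′)}) m′ z` of the straight `Lc`-contours of block `z` (direction `m′`) through the bond `(κ′,u′)`; hence
`lamCoeffK (KInvStep (j+1)) (E2 (j+1)) Lc μ y κ′ u′ = −(stepScale∕wVH)(j+1) · Σ'_z Σ_{m′} KInvStep (j+1)(Lc•y, Lc•z; inr μ, inr m′) · contourSum Lc (δ_{(κ′,u′)}) m′ z`
— at `j+1 = 1` exactly Engine C's structure `Λ(μ,κ′; u′ − Lc·y) = −Lc^{−(d+2)}·Σ_{s<Lc} wΦ^{(Lc²)}(κ′,μ; ⌊(u′ − s·e_{κ′})∕Lc⌋ − y)`. -/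
theorem lamCoeffK_KInvStep_E2_eq_coarse (j : ℕ) (μ : Fin (d + 1)) (y : Fin (d + 1) → ℤ) (κ' : Fin (d + 1)) (u' : Fin (d + 1) → ℤ) :
    lamCoeffK (KInvStep (d := d) Lc (j + 1)) (E2 d Lc (j + 1)) Lc μ y κ' u'
      = -(stepScale d Lc (j + 1) / wVH d Lc (j + 1)) *
          ∑' z, ∑ m' : Fin (d + 1), KInvStep (d := d) Lc (j + 1) ((Lc : ℤ) • y) ((Lc : ℤ) • z) (Sum.inr μ) (Sum.inr m')
            * contourSum Lc (delta1 κ' u') m' z := by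
  rw [lamCoeffK_KInvStep_E2_eq]
  congr 1
  rw [← tsum_sublattice Lc 0 (fun z => ∑ m' : Fin (d + 1),
    KInvStep (d := d) Lc (j + 1) ((Lc : ℤ) • y) ((Lc : ℤ) • z) (Sum.inr μ) (Sum.inr m') * contourSum Lc (delta1 κ' u') m' z)]
  refine tsum_congr fun v => ?_
  simp only [sub_zero]
  by_cases hv : Torus.proj Lc v = 0
  · rw [if_pos hv]
    have e := eq_zsmul_quo_of_proj (N := Lc) hv
    refine Finset.sum_congr rfl fun m' _ => ?_
    rw [bhK_inr_inl, if_pos hv, ← e]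
  · rw [if_neg hv]
    exact Finset.sum_eq_zero fun m' _ => by rw [bhK_inr_inl, if_neg hv, mul_zero]

end Summit.QuantumFields.BalabanUV.Beta.LamCoeffKClosedForm

end
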